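import Literature.Barriers.ABC.BakerMethodBounds
import Literature.NumberTheory.DiophantineGeometry.MultiplicativeGroupApproximation
import HarnessLib

/-!
# Győry 2019 (Publ. Math. Debrecen 94), Theorem 1 over `ℚ`: the `S`-unit bound in which the THIRD
# largest prime enters linearly — and its `abc`-currency form (the Győry–Le Fourn bound)

Topic `NumberTheory/DiophantineGeometry`; namespace `Literature.NumberTheory.DiophantineGeometry`
(API in the sub-namespace `Gyory2019`, which names the paper). Requested by the `decomp-abc` cell
(lens-3 g8 «Baker lever atlas», dial ρ; work item `wi-97428`, routes `route-ABC-RootDecompA/K/I`):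
the kernel's hypothesis `GyoryLeFournBound` is delivered here as the PROVED consequence
`Gyory2019.gyoryLeFournBound` of the named fact `gyory2019_thm1_rat` (the printed theorem at `K = ℚ`).

Source: K. Győry, *Bounds for the solutions of `S`-unit equations and decomposable form equations
II*, Publ. Math. Debrecen **94** (2019), 507–526 [Gyory2019] — HELD (`paper:arxiv-1901.11289`), read
on the page (§2, held-text chunks p0002–p0004; §4, p0011). Notation of the paper (§2, p0002): `K` a
number field of degree `d`, unit rank `r`, class number `h_K`, regulator `R_K`; `S ⊇ S_∞` a finite
set of places, `s = |S| = r + t + 1`, `𝔭₁, …, 𝔭_t` the prime ideals in `S`, `P_S = max N(𝔭ᵢ)` (`1` if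
`t = 0`), `R_S` the `S`-regulator; the `S`-unit equation **(1.a)** `α x + β y = 1` in `x, y ∈ 𝓞_S^*`,
`H = max(h(α), h(β), 1)` (absolute logarithmic heights); «we use the notation `log* a = max(log a, 1)`
for `a > 0`» (the tree's `Dioph.logStar`, REUSED); `𝓡 = max(h_K, c₃ d R_K)` with `c₃ = 0` if `r = 0`
(p0003); and (p0003, verbatim)
«`P'_S` = the third largest value of `N(𝔭ᵢ)`, `i = 1, …, t`, if `t ≥ 3`, and `1` if `t ≤ 2`».

**Theorem 1** (p0003, verbatim). «Let `t > 0`. Every solution `x, y` of equation (1.a) satisfies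
`max(h(x), h(y)) < c₅(d, r, s, t) 𝓡^{t+4} (P'_S / log* P'_S) (1 + log* log P_S / log* P'_S) R_S H`
**(2.4)**, where `c₅(d, r, s, t) = s⁵ (16e)^{3r+4t+7} d^{4r+2t+7}`.» (Proof: §5, combining Le Fourn's
tubular Runge–Baker Proposition 4 [LeFourn 2020, ANT 14, Thm. 1.4 = the paper's Theorem C] with
Győry–Yu; linear forms in logarithms — XL, vendored as a named fact.)

THE CASE `K = ℚ`, `α = β = 1` (what this file types, `gyory2019_thm1_rat`). For an `abc` triple
`a + b = c` (coprime positive integers) put `S = {∞} ∪ {p : p ∣ abc}`; then `x = a/c`, `y = b/c` are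
`S`-units with `x + y = 1`, and `max(h(x), h(y)) = log c` (`gcd(a, c) = gcd(b, c) = 1`, `a, b < c`).
Here `d = 1`, `r = 0`, `h_ℚ = R_ℚ = 1`, so `𝓡 = max(1, 0) = 1`; `t = ω(abc)` (the number of distinct
prime factors, `(a*b*c).primeFactors.card`), `s = t + 1`, `c₅ = (t+1)⁵ (16e)^{4t+7}`; `N(𝔭ᵢ) = pᵢ`, so
`P_S = P(abc)` is the greatest prime factor (the tree's `Literature.Barriers.ABC.largestPrimeFactor`,
REUSED) and `P'_S` is the third largest prime factor of `abc`, `1` if `ω(abc) ≤ 2` (typed here: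
`thirdLargestPrimeFactor`, a definition with body); `R_S = ∏_{p ∣ abc} log p` exactly (§4, p0011:
«`R_K ∏ log N(𝔭ᵢ) ≤ R_S ≤ R_K h_K ∏ log N(𝔭ᵢ)`» with `R_ℚ = h_ℚ = 1`); `H = max(h(1), h(1), 1) = 1`;
and `t > 0` holds since `c ≥ 2`. Hence (2.4) reads
`log c < (t+1)⁵ (16e)^{4t+7} · (P'/log* P') · (1 + log*(log P)/log* P') · ∏_{p ∣ abc} log p`.
-- TODO(general form): Theorem 1 for an arbitrary number field `K` and coefficients `α, β`
-- (`S`-regulator, `𝓡`, heights `h(x)`): the tree has no `S`-regulator; no consumer exists.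

PROVED here: the `abc`-CURRENCY WEAKENING used by the kernel (its `GyoryLeFournBound`, verbatim as
the conclusion of `Gyory2019.gyoryLeFournBound`): for any set `Q` of at most two primes of `abc` and
any `y ≥ 1` bounding every other prime of `abc`, `P' ≤ y` (`thirdLargestPrimeFactor_le`: otherwise
`P'` and the two primes above it are three primes `> y`, all in `Q`), `P'/log* P' ≤ P' ≤ y`
(`log* ≥ 1`), and `1 + log*(log P)/log* P' ≤ 1 + log*(log P) ≤ 1 + max(1, log(max(1, log rad)))`
(`2 ≤ P ≤ rad`), whence
`log c < (ω+1)⁵ (16e)^{4ω+7} · y · (1 + max(1, log max(1, log rad))) · ∏_{p ∣ abc} log p`.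
One named fact (`gyory2019_thm1_rat`, net debt +1); one definition with body
(`thirdLargestPrimeFactor`) and its API; no `sorry`, no `instance`, no notation.

## References
* [Gyory2019] K. Győry, Publ. Math. Debrecen 94 (2019), 507–526, Theorem 1, (2.4) (arXiv:1901.11289,
  p. 3); §4 (the `S`-regulator).
* [Lefourn2020] S. Le Fourn, *Tubular approaches to Baker's method for curves and varieties*, Algebra
  & Number Theory 14 (2020), 763–785, Thm. 1.4 (= Győry's Theorem C; the Runge ingredient).
* Tree: `AbcWave0` (`IsABCTriple`, `rad`), `Literature.Barriers.ABC.BakerMethodBounds`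
  (`largestPrimeFactor`), `MultiplicativeGroupApproximation` (`Dioph.logStar`, `one_le_logStar`);
  compare `AbcGyory2008` (Győry 2008 over `ℚ`, greatest prime factor) and `AbcStewartYu2001`.
-/

open Finset
open Literature.NumberTheory.DiophantineGeometry.Dioph (logStar logStar_def one_le_logStar)
open Literature.Barriers.ABC (largestPrimeFactor largestPrimeFactor_def)

namespace Literature.NumberTheory.DiophantineGeometry

/-! ### Győry's `P'_S` for `K = ℚ`: the third largest prime factor -/

/-- **`P'(n)`, the third largest prime factor of `n`** — «the third largest value of `N(𝔭ᵢ)`,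
`i = 1, …, t`, if `t ≥ 3`, `1` if `t ≤ 2`» for `K = ℚ`, `S = {∞} ∪ {p : p ∣ n}`: the largest prime
factor `p` of `n` having at least two prime factors of `n` above it, and `1` if there is none
(`max 1 (sup …)`, the empty `sup` being `0`). [cite: Gyory2019, §2, definition of P'_S (p. 3)] -/
def thirdLargestPrimeFactor (n : ℕ) : ℕ :=
  max 1 ((n.primeFactors.filter fun p ↦ 2 ≤ (n.primeFactors.filter fun q ↦ p < q).card).sup id)

/-- Unfolding lemma for `thirdLargestPrimeFactor`. [cite: Gyory2019, §2, definition of P'_S (p. 3)] -/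
theorem thirdLargestPrimeFactor_def (n : ℕ) : thirdLargestPrimeFactor n =
    max 1 ((n.primeFactors.filter fun p ↦ 2 ≤ (n.primeFactors.filter fun q ↦ p < q).card).sup id) :=
  rfl

/-- `P'(n) ≥ 1`. [cite: Gyory2019, §2, definition of P'_S (p. 3)] -/
theorem one_le_thirdLargestPrimeFactor (n : ℕ) : 1 ≤ thirdLargestPrimeFactor n :=
  le_max_left _ _

/-- **Two primes are free, the third carries**: if every prime factor of `n` outside a set `Q` of at
most two elements is `≤ y` (`y ≥ 1`), then `P'(n) ≤ y` — otherwise `P'(n)` and the two prime factors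
above it would be three primes `> y`, all inside `Q`. [cite: Gyory2019, §2, definition of P'_S (p. 3)] -/
theorem thirdLargestPrimeFactor_le {n y : ℕ} {Q : Finset ℕ} (hQ : Q.card ≤ 2) (hy : 1 ≤ y)
    (h : ∀ p ∈ n.primeFactors, p ∉ Q → p ≤ y) : thirdLargestPrimeFactor n ≤ y := by
  rw [thirdLargestPrimeFactor_def]
  refine max_le hy (Finset.sup_le fun p hp ↦ ?_)
  rw [Finset.mem_filter] at hp
  obtain ⟨hpn, hcard⟩ := hp
  by_contra hpy
  rw [not_le] at hpy
  have hsub : insert p (n.primeFactors.filter fun q ↦ p < q) ⊆ Q := by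
    intro q hq
    rw [Finset.mem_insert] at hq
    by_contra hqQ
    rcases hq with rfl | hq
    · exact absurd (h q hpn hqQ) (not_le.2 hpy)
    · rw [Finset.mem_filter] at hq
      exact absurd (h q hq.1 hqQ) (not_le.2 (hpy.trans (by exact_mod_cast hq.2)))
  have hcard3 : 3 ≤ (insert p (n.primeFactors.filter fun q ↦ p < q)).card := by
    rw [Finset.card_insert_of_notMem (by simp)]
    omega
  have := (hcard3.trans (Finset.card_le_card hsub)).trans hQ
  omega

/-! ### The named fact: Theorem 1 at `K = ℚ`, `α = β = 1` -/

/-- **Győry 2019, Theorem 1, (2.4), in the case `K = ℚ`, `α = β = 1`** («Let `t > 0`. Every solution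
`x, y` of `αx + βy = 1` in `S`-units satisfies `max(h(x), h(y)) < c₅(d,r,s,t) 𝓡^{t+4} (P'_S/log* P'_S)
(1 + log* log P_S / log* P'_S) R_S H`, `c₅ = s⁵ (16e)^{3r+4t+7} d^{4r+2t+7}`»), read for an `abc`
triple `a + b = c` with `S = {∞} ∪ {p ∣ abc}`, `x = a/c`, `y = b/c` (so `max(h(x), h(y)) = log c`),
`d = 1`, `r = 0`, `𝓡 = 1`, `s = t + 1`, `t = ω(abc) > 0`, `P_S = P(abc)` the greatest and `P'_S` the
third largest prime factor of `abc` (`1` if `ω(abc) ≤ 2`), `R_S = ∏_{p ∣ abc} log p`, `H = 1`: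
`log c < (t+1)⁵ (16e)^{4t+7} · (P'/log* P') · (1 + log*(log P)/log* P') · ∏_{p ∣ abc} log p`.
Proof in print by linear forms in logarithms and Le Fourn's tubular Runge method (XL) — a THEOREM,
vendored as a named fact. [cite: Gyory2019, Theorem 1, (2.4) (p. 3); §4 (R_S for K = ℚ)]
[cite: Lefourn2020, Theorem 1.4] -/
def gyory2019_thm1_rat : Prop :=
  ∀ a b c : ℕ, IsABCTriple a b c →
    Real.log c <
      (((a * b * c).primeFactors.card : ℝ) + 1) ^ 5 *
        (16 * Real.exp 1) ^ (4 * (a * b * c).primeFactors.card + 7) *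
        ((thirdLargestPrimeFactor (a * b * c) : ℝ) / logStar (thirdLargestPrimeFactor (a * b * c))) *
        (1 + logStar (Real.log (largestPrimeFactor (a * b * c))) /
          logStar (thirdLargestPrimeFactor (a * b * c))) *
        ∏ p ∈ (a * b * c).primeFactors, Real.log p

namespace Gyory2019

/-- For an `abc` triple, `abc` has a prime factor (`c ≥ 2`), so Theorem 1's hypothesis `t > 0` holds.
[cite: Gyory2019, Theorem 1 (hypothesis t > 0)] -/
theorem primeFactors_nonempty {a b c : ℕ} (h : IsABCTriple a b c) : (a * b * c).primeFactors.Nonempty := by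
  obtain ⟨ha, hb, habc, -⟩ := h
  rw [Nat.nonempty_primeFactors]
  calc 1 < c := by omega
    _ ≤ a * b * c := Nat.le_mul_of_pos_left c (Nat.mul_pos ha hb)

/-- `2 ≤ P(n)` as soon as `n` has a prime factor. [cite: Gyory2019, §2, definition of P_S (p. 2)] -/
theorem two_le_largestPrimeFactor {n : ℕ} (hn : n.primeFactors.Nonempty) : 2 ≤ largestPrimeFactor n := by
  obtain ⟨q, hq⟩ := hn
  rw [largestPrimeFactor_def]
  exact ((Nat.prime_of_mem_primeFactors hq).two_le.trans (Finset.le_sup (f := id) hq)).trans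
    (le_max_right _ _)

/-- `P(abc) ≤ rad(abc)`: every prime factor divides the radical `∏_{p ∣ abc} p`.
[cite: Gyory2019, §2, definition of P_S (p. 2)] -/
theorem largestPrimeFactor_le_rad (a b c : ℕ) : largestPrimeFactor (a * b * c) ≤ rad a b c := by
  have hrad : rad a b c = ∏ p ∈ (a * b * c).primeFactors, p := by
    rw [rad_def, Nat.radical_eq_prod_primeFactors]
  have hpos : 0 < ∏ p ∈ (a * b * c).primeFactors, p :=
    Finset.prod_pos fun p hp ↦ Nat.pos_of_mem_primeFactors hp
  rw [largestPrimeFactor_def, hrad]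
  refine max_le hpos (Finset.sup_le fun q hq ↦ ?_)
  exact Nat.le_of_dvd hpos (Finset.dvd_prod_of_mem _ hq)

/-- `P'/log* P' ≤ y` under the two-free-primes hypothesis (`P' ≤ y`, `log* ≥ 1`).
[cite: Gyory2019, Theorem 1, (2.4) (the factor P'_S / log* P'_S)] -/
theorem thirdLargest_div_logStar_le {n y : ℕ} {Q : Finset ℕ} (hQ : Q.card ≤ 2) (hy : 1 ≤ y)
    (h : ∀ p ∈ n.primeFactors, p ∉ Q → p ≤ y) :
    (thirdLargestPrimeFactor n : ℝ) / logStar (thirdLargestPrimeFactor n) ≤ y :=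
  (div_le_self (Nat.cast_nonneg _) (one_le_logStar _)).trans
    (by exact_mod_cast thirdLargestPrimeFactor_le hQ hy h)

/-- `1 + log*(log P)/log* P' ≤ 1 + max(1, log max(1, log rad))` for an `abc` triple (`2 ≤ P ≤ rad`,
`log* ≥ 1`). [cite: Gyory2019, Theorem 1, (2.4) (the factor 1 + log* log P_S / log* P'_S)] -/
theorem one_add_logStar_log_div_le {a b c : ℕ} (h : IsABCTriple a b c) (u : ℝ) (hu : 1 ≤ u) :
    1 + logStar (Real.log (largestPrimeFactor (a * b * c))) / u ≤
      1 + max 1 (Real.log (max 1 (Real.log ((rad a b c : ℕ) : ℝ)))) := by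
  have hP2 : (2 : ℝ) ≤ largestPrimeFactor (a * b * c) := by
    exact_mod_cast two_le_largestPrimeFactor (primeFactors_nonempty h)
  have hlogP : 0 < Real.log (largestPrimeFactor (a * b * c)) := Real.log_pos (by linarith)
  have hPrad : (largestPrimeFactor (a * b * c) : ℝ) ≤ ((rad a b c : ℕ) : ℝ) := by
    exact_mod_cast largestPrimeFactor_le_rad a b c
  refine add_le_add le_rfl ?_
  calc logStar (Real.log (largestPrimeFactor (a * b * c))) / u
      ≤ logStar (Real.log (largestPrimeFactor (a * b * c))) :=
        div_le_self (zero_le_one.trans (one_le_logStar _)) hu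
    _ ≤ max 1 (Real.log (max 1 (Real.log ((rad a b c : ℕ) : ℝ)))) := by
        rw [logStar_def]
        refine max_le_max le_rfl (Real.log_le_log hlogP ?_)
        exact (Real.log_le_log (by linarith) hPrad).trans (le_max_right _ _)

/-- **The Győry–Le Fourn bound in `abc` currency** (the `decomp-abc` kernel's `GyoryLeFournBound`,
verbatim, as a CONSEQUENCE of Theorem 1 over `ℚ`): for every `abc` triple, every set `Q` of at most two
primes of `abc` and every `y ≥ 1` bounding all the other primes of `abc`,
`log c < (ω+1)⁵ (16e)^{4ω+7} · y · (1 + max(1, log max(1, log rad))) · ∏_{p ∣ abc} log p`, `ω = ω(abc)`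
— from (2.4) by the monotone weakenings `P'/log* P' ≤ y` (`thirdLargest_div_logStar_le`) and
`1 + log*(log P)/log* P' ≤ 1 + max(1, log max(1, log rad))` (`one_add_logStar_log_div_le`).
[cite: Gyory2019, Theorem 1, (2.4) (p. 3)] [cite: Lefourn2020, Theorem 1.4] -/
theorem gyoryLeFournBound (hG : gyory2019_thm1_rat) :
    ∀ a b c : ℕ, IsABCTriple a b c → ∀ Q : Finset ℕ, Q ⊆ (a * b * c).primeFactors → Q.card ≤ 2 →
      ∀ y : ℕ, 1 ≤ y → (∀ p ∈ (a * b * c).primeFactors, p ∉ Q → p ≤ y) →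
        Real.log c < (((a * b * c).primeFactors.card : ℝ) + 1) ^ 5 *
          (16 * Real.exp 1) ^ (4 * (a * b * c).primeFactors.card + 7) * (y : ℝ) *
          (1 + max 1 (Real.log (max 1 (Real.log ((rad a b c : ℕ) : ℝ))))) *
          ∏ p ∈ (a * b * c).primeFactors, Real.log p := by
  intro a b c h Q _hQ hQ2 y hy hpy
  refine (hG a b c h).trans_le ?_
  have hR : 0 ≤ ∏ p ∈ (a * b * c).primeFactors, Real.log (p : ℝ) :=
    Finset.prod_nonneg fun p hp ↦ Real.log_nonneg
      (by exact_mod_cast (Nat.prime_of_mem_primeFactors hp).one_lt.le)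
  have h1 := thirdLargest_div_logStar_le (n := a * b * c) hQ2 hy hpy
  have h2 := one_add_logStar_log_div_le h (logStar (thirdLargestPrimeFactor (a * b * c)))
    (one_le_logStar _)
  have h1nn : 0 ≤ (thirdLargestPrimeFactor (a * b * c) : ℝ) /
      logStar (thirdLargestPrimeFactor (a * b * c)) :=
    div_nonneg (Nat.cast_nonneg _) (zero_le_one.trans (one_le_logStar _))
  have h2nn : 0 ≤ 1 + logStar (Real.log (largestPrimeFactor (a * b * c))) /
      logStar (thirdLargestPrimeFactor (a * b * c)) :=
    add_nonneg zero_le_one (div_nonneg (zero_le_one.trans (one_le_logStar _))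
      (zero_le_one.trans (one_le_logStar _)))
  gcongr

end Gyory2019

end Literature.NumberTheory.DiophantineGeometry
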